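import Summits.BirchSwinnertonDyer.BirchSwinnertonDyer.Theses.KolyvaginRankRigidityAtTwo
import Summits.BirchSwinnertonDyer.BirchSwinnertonDyer.Theses.GenusKolyvaginAtTwo
import Summits.BirchSwinnertonDyer.BirchSwinnertonDyer.Theorems.KolyvaginRankRigidityAtTwoSwapTwoTermReciprocity
import Summits.BirchSwinnertonDyer.BirchSwinnertonDyer.Theorems.KolyvaginRankRigidityAtTwoChebotarevWindowPrimeAtTwo
import Summits.BirchSwinnertonDyer.BirchSwinnertonDyer.Theorems.KolyvaginRankRigidityAtTwoKolyvaginCorankLowerBoundAtTwoMarginChebotarevOneClassIndexAtTwo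
import Summits.BirchSwinnertonDyer.BirchSwinnertonDyer.Theorems.KolyvaginRankRigidityAtTwoKolyvaginCorankLowerBoundAtTwoConjSign
import Summits.BirchSwinnertonDyer.BirchSwinnertonDyer.Theorems.KolyvaginRankRigidityAtTwoKolyvaginCorankLowerBoundAtTwoSelmerAwayFromConductor
import Summits.BirchSwinnertonDyer.BirchSwinnertonDyer.Theorems.Rank1ResidualJetCompatibleDataTriple
import HarnessLib

/-!
# Crux V2♭θ / V2♭∞ (stmt-BirchSwinnertonDyer-27220; line `kolyvagin_depth_split`), stub S1 — the prime
# swap at 2 FROM ITS PIECES (S1-PLAN, crux dir): the STATEMENT of the composition (interface for the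
# width seats), proof in progress

`primeSwapAtTwoLossy_of_pieces`: the registered S1L text (lossy swap: test clause and output exponent
`j − c₂`) for a fixed frame follows from
* P4 `hP4` — transversality of `c_M(n)` at the primes of `n` (margin one) [⇐ Gross 1991 Prop. 3.7 (2)];
* P5 `hP5` — an auxiliary class of order `≥ 2^{M/2 − c₅}` in the `ε`-part of `H¹_{𝓕(m)^{v₀}}`;
* P7 `hP7a` / `hP7b` — lower / upper bounds of the local pairing orders at a Kolyvagin prime;
* P8 `h𝒯σ`, `h𝒯sd`, `hdisj` — the transverse-structure package at `2` (hypotheses even at odd `p` in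
  the tree's `Rank1ResidualJetSwapLevelRaising`);
* the Poitou–Tate family (`hPT`, named fact `poitouTate_selmerStructure_duality_conj`), a Weil datum,
* and the LANDED pieces: P1 (`JET.exists_compatible_data_triple_of_grossCM`), P6
  (`localTatePairing_add_eq_zero_of_swap`, p623050), the pair Čebotarev at `2`
  (`exists_kolyvaginPrime_notMem_pair_of_heegner`, krr2-p2), S2 (`stub_chebotarevOneClassIndexAtTwo`,
  krr2-p2), T2 (p612348), T3 (p611883), and Q2 `KolyvaginRelationAtTwo` BY NAME (landed modulo
  Gross 1991 Prop. 3.7 (2), p614530).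
Order arithmetic: `c₂ = c₁ + c₇ + c₇' + 4`, `c₀ = 2 (c₅ + c₇ + t + 3) + 2`. HONEST FRAMING: workfile with
`sorry` (the plumbing proof is in progress); nothing here proves S1, V2♭θ or BSD.
-/

set_option autoImplicit false
set_option linter.dupNamespace false

noncomputable section

open scoped Classical Pointwise
open Function NumberField IsDedekindDomain WeierstrassCurve Field
open Literature.NumberTheory.EllipticCurves Literature.NumberTheory.GaloisRepresentations
open Literature.NumberTheory.EllipticCurves.Jetchev2008 Literature.NumberTheory.EllipticCurves.ModularForms
open Literature.NumberTheory.GaloisCohomology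
open Literature.NumberTheory.GaloisRepresentations.DiscreteGaloisModule (localTatePairingZMod
  tateDual SelmerStructure)
open Summit.BirchSwinnertonDyer.Rank1Residual.JET.SelmerVocabulary
open Summit.BirchSwinnertonDyer.Rank1Residual.JET.GlobalDuality
open Summit.BirchSwinnertonDyer.BirchSwinnertonDyer.Theses.KolyvaginRankRigidityAtTwo
open Summit.BirchSwinnertonDyer.BirchSwinnertonDyer.Theses.GenusKolyvaginAtTwo (KolyvaginRelationAtTwo)

namespace Summit.BirchSwinnertonDyer.BirchSwinnertonDyer.Theorems.KolyvaginLowerBoundAtTwo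

variable {K : Type} [Field K] [NumberField K] (W : WeierstrassCurve ℚ) [W.IsElliptic]
  [W.IsGloballyMinimal] [(W.baseChange K).IsElliptic] [NeZero (W.conductorNorm ℤ)]
  [∀ M : ℕ, NeZero (2 ^ M)] [∀ M : ℕ, Finite (geomTorsion (W.baseChange K) ((2 ^ M : ℕ) : ℤ))]
  (τ : K ≃ₐ[ℚ] K)
  (Dt : ModularParametrizationData W (W.conductorNorm ℤ)) (β : ℤ) (ι : K →+* ℂ)
  -- the Weil data, one per level
  (e : ∀ M : ℕ, geomTorsion (W.baseChange K) ((2 ^ M : ℕ) : ℤ) →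
    geomTorsion (W.baseChange K) ((2 ^ M : ℕ) : ℤ) → AlgebraicClosure K)
  (hμ : ∀ M S T, e M S T ^ (2 ^ M) = 1)
  (hadd₁ : ∀ M S₁ S₂ T, e M (S₁ + S₂) T = e M S₁ T * e M S₂ T)
  (hadd₂ : ∀ M S T₁ T₂, e M S (T₁ + T₂) = e M S T₁ * e M S T₂)
  (hgal : ∀ M (g : absoluteGaloisGroup K) (S T : geomTorsion (W.baseChange K) ((2 ^ M : ℕ) : ℤ)),
    g • e M S T = e M (g • S) (g • T))
  (halt : ∀ M T, e M T T = 1) (hnondeg : ∀ M T, (∀ S, e M S T = 1) → T = 0)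
  -- the Poitou–Tate families, one per level
  (inv : ∀ M : ℕ, LocalInvariants K (2 ^ M))
  -- the transverse structures, one per level (independent of the conductor, as in `Swap.not_dvd_of_swap`)
  (𝒯 : ∀ M : ℕ, SelmerStructure ((W.baseChange K).torsionGaloisModule ((2 ^ M : ℕ) : ℤ)))

/-- The pairing value `⟨loc_v w, loc_v (w_* C)⟩_v ∈ ℤ/2^M` at a finite place (notation of the pieces P6, P7). -/
def swapPairing (M : ℕ) (v : HeightOneSpectrum (𝓞 K))
    (w C : galoisCohomology ((W.baseChange K).torsionGaloisModule ((2 ^ M : ℕ) : ℤ)) 1) : ZMod (2 ^ M) :=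
  localTatePairingZMod ((W.baseChange K).torsionGaloisModule ((2 ^ M : ℕ) : ℤ)) (2 ^ M) (Sum.inr v)
    (inv M (Sum.inr v))
    (galoisCohomology.localization ((W.baseChange K).torsionGaloisModule ((2 ^ M : ℕ) : ℤ)) (Sum.inr v) 1 w)
    (galoisCohomology.localization (((W.baseChange K).torsionGaloisModule ((2 ^ M : ℕ) : ℤ)).tateDual (2 ^ M))
      (Sum.inr v) 1
      (galoisCohomology.map (weilDualIntertwining (W.baseChange K) (2 ^ M) (e M) (hμ M) (hadd₁ M) (hadd₂ M)
        (hgal M)) 1 C))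

/-- **The prime swap at `2` (lossy form, S1L) from its pieces** — statement; see the module docstring
and `S1-PLAN.md` (crux dir). [cite: Kolyvagin1991MathAnn, §2 Thm. 2.2 (ref. [1] Prop. 8), p. 257]
[cite: McCallumLMS1991, §5 Prop. 5.2, Lemma 5.3] [cite: WZhang2014, Lemma 8.2, Lemma 8.4] -/
theorem primeSwapAtTwoLossy_of_pieces (hCM : ¬ W.HasCM)
    (hred : Rank1Residual.GoodOrd W 2 ∨ Rank1Residual.Mult W 2)
    (hsur : ∀ m : ℕ, W.HasSurjectiveModNGaloisRep (2 ^ m : ℕ)) (hK : IsImaginaryQuadratic K)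
    (hne3 : NumberField.discr K ≠ -3) (hne4 : NumberField.discr K ≠ -4)
    (h2d : ¬ ((2 : ℤ) ∣ NumberField.discr K)) (hHN : SatisfiesHeegnerHypothesis (W.conductorNorm ℤ) K)
    (hτ1 : τ ≠ 1)
    (hperf : ∀ M, (inv M).IsPerfect) (hvan : ∀ M, (inv M).SumLocalTermEqZero)
    -- P8: the transverse package at `2`
    (h𝒯sd : ∀ (M c : ℕ), ∀ v ∈ placesDividing K c,
      (inv M).dualTransported (𝒯 M) (weilDualIntertwining (W.baseChange K) (2 ^ M) (e M) (hμ M) (hadd₁ M)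
        (hadd₂ M) (hgal M)) (Sum.inr v) = 𝒯 M (Sum.inr v))
    (hdisj : ∀ (M q : ℕ), Zhang2014.IsKolyvaginPrime (W.conductorNorm ℤ) W K 2 q →
      M + 1 ≤ Zhang2014.kolyvaginIndex W 2 q → ∀ v : HeightOneSpectrum (𝓞 K), ((q : ℕ) : 𝓞 K) ∈ v.asIdeal →
      Disjoint ((W.baseChange K).kummerSelmerStructure ((2 ^ M : ℕ) : ℤ) (Sum.inr v)) (𝒯 M (Sum.inr v)))
    -- P4: transversality at the primes of the conductor (margin one)
    (hP4 : ∀ (M c : ℕ) (dat : KolyvaginHeegnerData Dt β ι c),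
      KolyvaginDescent.KolSupp (Zhang2014.IsKolyvaginPrime (W.conductorNorm ℤ) W K 2) c → 1 ≤ M →
      (∀ q ∈ c.primeFactors, M + 1 ≤ Zhang2014.kolyvaginIndex W 2 q) →
      ∀ w ∈ placesDividing K c,
        galoisCohomology.localization ((W.baseChange K).torsionGaloisModule ((2 ^ M : ℕ) : ℤ)) (Sum.inr w) 1 (dat.kolyvaginClass Nat.prime_two M) ∈ 𝒯 M (Sum.inr w))
    -- P5: auxiliary classes of order ≥ 2^(M/2 - c₅)
    (c₅ : ℕ)
    (hP5 : ∀ (M m a : ℕ) (v₀ : HeightOneSpectrum (𝓞 K)) (s : ℤ), (s = 1 ∨ s = -1) → 1 ≤ M →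
      KolyvaginDescent.KolSupp (Zhang2014.IsKolyvaginPrime (W.conductorNorm ℤ) W K 2) m →
      (∀ q ∈ m.primeFactors, M + 1 ≤ Zhang2014.kolyvaginIndex W 2 q) →
      Zhang2014.IsKolyvaginPrime (W.conductorNorm ℤ) W K 2 a → M + 1 ≤ Zhang2014.kolyvaginIndex W 2 a →
      ¬ a ∣ m → ((a : ℕ) : 𝓞 K) ∈ v₀.asIdeal →
      ∃ w : galoisCohomology ((W.baseChange K).torsionGaloisModule ((2 ^ M : ℕ) : ℤ)) 1,
        w ∈ signPart W K τ ((2 ^ M : ℕ) : ℤ) s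
          (((selmerF W ((2 ^ M : ℕ) : ℤ) (𝒯 M) (placesDividing K m)).relaxedAt {v₀}).selmerGroup) ∧
        ((2 ^ (M / 2 - c₅) : ℕ) : ℤ) • w ≠ 0)
    -- P7a: lower bound of the pairing order at a fresh Kolyvagin prime
    (c₇ : ℕ)
    (hP7a : ∀ (M ℓ : ℕ) (v : HeightOneSpectrum (𝓞 K)) (w C : galoisCohomology ((W.baseChange K).torsionGaloisModule ((2 ^ M : ℕ) : ℤ)) 1) (s : ℤ) (a b : ℕ),
      (s = 1 ∨ s = -1) → Zhang2014.IsKolyvaginPrime (W.conductorNorm ℤ) W K 2 ℓ →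
      M ≤ Zhang2014.kolyvaginIndex W 2 ℓ → ((ℓ : ℕ) : 𝓞 K) ∈ v.asIdeal →
      conjAct W τ ((2 ^ M : ℕ) : ℤ) w = s • w → conjAct W τ ((2 ^ M : ℕ) : ℤ) C = s • C →
      galoisCohomology.localization ((W.baseChange K).torsionGaloisModule ((2 ^ M : ℕ) : ℤ)) (Sum.inr v) 1 w ∈
        (W.baseChange K).kummerSelmerStructure ((2 ^ M : ℕ) : ℤ) (Sum.inr v) →
      ((2 ^ a : ℕ) : ℤ) • galoisCohomology.localization ((W.baseChange K).torsionGaloisModule ((2 ^ M : ℕ) : ℤ)) (Sum.inr v) 1 w ≠ 0 →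
      ((2 ^ b : ℕ) : ℤ) • galoisCohomology.localization ((W.baseChange K).torsionGaloisModule ((2 ^ M : ℕ) : ℤ)) (Sum.inr v) 1 C ∉
        (W.baseChange K).kummerSelmerStructure ((2 ^ M : ℕ) : ℤ) (Sum.inr v) →
      M + c₇ ≤ a + b + 1 →
      (2 ^ (a + b + 1 - M - c₇) : ℕ) • swapPairing W e hμ hadd₁ hadd₂ hgal inv M v w C ≠ 0)
    -- P7b: upper bound of the pairing order at the prime being swapped out
    (c₇' : ℕ)
    (hP7b : ∀ (M q : ℕ) (v : HeightOneSpectrum (𝓞 K)) (w C : galoisCohomology ((W.baseChange K).torsionGaloisModule ((2 ^ M : ℕ) : ℤ)) 1) (s : ℤ) (a₀ b₀ : ℕ),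
      (s = 1 ∨ s = -1) → Zhang2014.IsKolyvaginPrime (W.conductorNorm ℤ) W K 2 q →
      M + 1 ≤ Zhang2014.kolyvaginIndex W 2 q → ((q : ℕ) : 𝓞 K) ∈ v.asIdeal →
      conjAct W τ ((2 ^ M : ℕ) : ℤ) w = s • w → conjAct W τ ((2 ^ M : ℕ) : ℤ) C = s • C →
      galoisCohomology.localization ((W.baseChange K).torsionGaloisModule ((2 ^ M : ℕ) : ℤ)) (Sum.inr v) 1 C ∈ 𝒯 M (Sum.inr v) →
      ((2 ^ a₀ : ℕ) : ℤ) • galoisCohomology.localization ((W.baseChange K).torsionGaloisModule ((2 ^ M : ℕ) : ℤ)) (Sum.inr v) 1 w ∈ 𝒯 M (Sum.inr v) →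
      ((2 ^ b₀ : ℕ) : ℤ) • galoisCohomology.localization ((W.baseChange K).torsionGaloisModule ((2 ^ M : ℕ) : ℤ)) (Sum.inr v) 1 C = 0 →
      (2 ^ (a₀ + b₀ + c₇' - M) : ℕ) • swapPairing W e hμ hadd₁ hadd₂ hgal inv M v w C = 0)
    -- Q2 by name (landed modulo Gross 1991 Prop. 3.7 (2))
    (hQ2 : KolyvaginRelationAtTwo) :
    ∃ c₀ c₂ : ℕ, ∀ (M I : ℕ) (T : Finset ℕ) (a : ℕ)
      (dat : KolyvaginHeegnerData Dt β ι (∏ p ∈ T, p)) (j : ℕ) (X : Finset ℕ),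
      1 ≤ M → M + 1 ≤ I →
      (∀ p ∈ T, Zhang2014.IsKolyvaginPrime (W.conductorNorm ℤ) W K 2 p ∧
        M + 1 ≤ Zhang2014.kolyvaginIndex W 2 p) →
      a ∈ T → M + c₀ ≤ 2 * j →
      (∀ X' : Finset ℕ, ∃ q : ℕ, q ∉ X' ∧ Zhang2014.IsKolyvaginPrime (W.conductorNorm ℤ) W K 2 q ∧
        I ≤ Zhang2014.kolyvaginIndex W 2 q ∧
        ∃ v : HeightOneSpectrum (𝓞 K), ((q : ℕ) : 𝓞 K) ∈ v.asIdeal ∧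
          ((2 ^ j : ℕ) : ℤ) • dat.kolyvaginClass Nat.prime_two M ∉
            (W.baseChange K).torsionLocalKer (v.adicCompletion K) ((2 ^ M : ℕ) : ℤ)) →
      ∃ ℓ : ℕ, ℓ ∉ X ∧ ℓ ∉ T ∧ Zhang2014.IsKolyvaginPrime (W.conductorNorm ℤ) W K 2 ℓ ∧
        I ≤ Zhang2014.kolyvaginIndex W 2 ℓ ∧
        (∃ v : HeightOneSpectrum (𝓞 K), ((ℓ : ℕ) : 𝓞 K) ∈ v.asIdeal ∧
          ((2 ^ (j - c₂) : ℕ) : ℤ) • dat.kolyvaginClass Nat.prime_two M ∉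
            (W.baseChange K).torsionLocalKer (v.adicCompletion K) ((2 ^ M : ℕ) : ℤ)) ∧
        ∃ dat' : KolyvaginHeegnerData Dt β ι (∏ p ∈ insert ℓ (T.erase a), p),
          ∀ X' : Finset ℕ, ∃ q : ℕ, q ∉ X' ∧
            Zhang2014.IsKolyvaginPrime (W.conductorNorm ℤ) W K 2 q ∧
            I ≤ Zhang2014.kolyvaginIndex W 2 q ∧
            ∃ v : HeightOneSpectrum (𝓞 K), ((q : ℕ) : 𝓞 K) ∈ v.asIdeal ∧
              ((2 ^ (j - c₂) : ℕ) : ℤ) • dat'.kolyvaginClass Nat.prime_two M ∉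
                (W.baseChange K).torsionLocalKer (v.adicCompletion K) ((2 ^ M : ℕ) : ℤ) := by
  sorry

end Summit.BirchSwinnertonDyer.BirchSwinnertonDyer.Theorems.KolyvaginLowerBoundAtTwo

end
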